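import Summits.BirchSwinnertonDyer.BirchSwinnertonDyer.Theorems.ByReductionTypeAtTwoSupersingularUnitAnchorTransportMC
import Summits.BirchSwinnertonDyer.BirchSwinnertonDyer.Theorems.ThetaPartnerAtTwoTwoTorsionCongruence
import HarnessLib

/-!
# Crux `SupersingularRankZeroAtTwo` (item stmt-BirchSwinnertonDyer-19097): the UNIT-ANCHOR KIT DOOR on integer models, `Λ`-form —
# Kobayashi's `+` main conjecture at `2` and BSD₂ (NO descent certificate) of `M_E ⊗ ℚ` from a unit-zone anchor `M_A ⊗ ℚ`, a
# Tschirnhaus pair certifying `E[2] ≅ A[2]`, the `μ`/`λ`-transport binders at the pair and the per-class READING of `ϖ L♭_E`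
# (seat `bsd-2adic-ss-1x` GEN 4; unit-anchor transport road, doors p558810 / `…UnitAnchorTransportMC`)

HONEST FRAMING (cells `bsd-2adic` and `bsd-wall`; HUMAN RULINGS D-0036/D-0054/D-0074): THEOREMS ONLY — no definition, no named
fact, no instance, no `sorry`; nothing about any curve is asserted beyond the displayed binders; closes nothing by itself; BSD is
NOT proved by any of this. PARTITION (D-0054): X5@2 good-ss, `a₂ = 0` UNIT-ANCHOR sub-row (17/208 r0 classes; UNIT-ANCHOR-CENSUS-v1)
× `p = 2` — types-the-object-of; bears_on: K4-leaf crux 19097 · TP2 K1 20333 (its algebraic `μ`-half is the one transport binder).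

* `kobayashiMainConjecture_two_baseChange_int_of_unitAnchor_of_reading` / `bsdp_two_baseChange_int_of_unitAnchor_of_reading` — THE
  DOORS for integer models `M_E`, `M_A` (as in `…UnitAnchorKit`), a Tschirnhaus pair `(q, r)`, PUB `hmod`/`hGZK`/`h124`/`hX0`, the
  research binders AT THE PAIR {(2′)_E `hEC`, (4)ʳᵃᵗ_E `hCK`, (2′)_A `hECA`, `μ`-transport `hmuT`, `λ`-transport `hlamT` with its
  local terms evaluated to the numeral `ℓ`}, the unit-zone CERT of `A` and the READING `hCert` («`μ(G) = m ∧ λ(G) ≤ ℓ`» for every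
  integral multiple `ι G = 2^m ϖ ι L♭_E`; ENGINE-2) ⟹ `KobayashiMainConjecture (M_E ⊗ ℚ) 2 1` and `BSDp (M_E ⊗ ℚ) 2` — no `hsha`,
  no analytic transport, no CM hypothesis (via `SSUnitAnchor.kobayashiMainConjecture_two_of_unitAnchor` / `bsdp_two_of_unitAnchor_of_reading`).

References: [BDKim2009] Cor. 2.13; [GreenbergVatsal2000] Thm. (1.4), p. 2; [Kobayashi2003] Thm. 1.2, 4.1; [Kato2004Asterisque]
Thm. 12.4–12.5 (3); [BDKim2013] Cor. 3.15; [AbbesUllmo1996] Thm. A; [SilvermanAEC2009] III.§1; [Miller2011LMS] Def. 1.1;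
UNIT-ANCHOR-CENSUS-v1.md (run/shared/lean/pub/bsd-2adic/ss1x/gen4/).
-/

set_option autoImplicit false
-- the Theorems namespace of this sub repeats the summit name by design (D-0017 nested layout)
set_option linter.dupNamespace false

noncomputable section

open scoped Classical Polynomial

open CongruenceSubgroup WeierstrassCurve Literature.NumberTheory.EllipticCurves
  Literature.NumberTheory.EllipticCurves.ModularForms Summit.BirchSwinnertonDyer.Rank1Residual.X1.MuLambda
  Literature.NumberTheory.EllipticCurves.Rank1Residual Literature.NumberTheory.EllipticCurves.Rank1Residual.Typed
  Literature.NumberTheory.EllipticCurves.Kobayashi2003 Literature.NumberTheory.EllipticCurves.IwasawaDual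
  ZpExtension Summit.BirchSwinnertonDyer.Rank1Residual Summit.BirchSwinnertonDyer.Rank1Residual.Supersingular
  Summit.BirchSwinnertonDyer.Rank1Residual.X5 Summit.BirchSwinnertonDyer.Rank1Residual.X5.O1

namespace Summit.BirchSwinnertonDyer.BirchSwinnertonDyer.Theorems
namespace SSUnitAnchor

section Door

variable (ME MA : WeierstrassCurve ℤ)
  [(ME.baseChange ℚ).IsElliptic] [(ME.baseChange ℚ).IsGloballyMinimal]
  [(MA.baseChange ℚ).IsElliptic] [(MA.baseChange ℚ).IsGloballyMinimal]

/-- **THE KIT DOOR, `Λ`-form: Kobayashi's `+` main conjecture at `2` for `M_E ⊗ ℚ`.** Binders as in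
`missingUpperBoundAt_two_baseChange_int_of_unitAnchor` (without `h2`) plus the `λ`-transport `hlamT` (numeral `ℓ`) and the READING
`hCert` of `ϖ L♭_E` ⟹ `KobayashiMainConjecture (M_E ⊗ ℚ) 2 1`. [cite: BDKim2009, Cor. 2.13 and Prop. 2.6]
[cite: GreenbergVatsal2000, Thm. (1.4) and Prop. (2.4)] [cite: Kobayashi2003, Thm. 1.2, Thm. 4.1 and Conjecture (p. 2)]
[cite: Kato2004Asterisque, Thm. 12.4–12.5 (3)] [cite: SilvermanAEC2009, III.§1] [cite: Washington1997, §13.2] -/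
theorem kobayashiMainConjecture_two_baseChange_int_of_unitAnchor_of_reading
    (hmod : nonempty_modularParametrizationData) (hGZK : rank_eq_analyticRank_of_analyticRank_le_one)
    (h124 : Kato2004.thm12_4) (hX0 : Kato2004_fineSelmerDual_isTorsion)
    (hL : (ME.baseChange ℚ).entireLFunction 1 ≠ 0)
    (hss : GoodSS (ME.baseChange ℚ) 2) (ha : (ME.baseChange ℚ).frobeniusTrace 2 = 0)
    (hLA : (MA.baseChange ℚ).entireLFunction 1 ≠ 0)
    (hAss : GoodSS (MA.baseChange ℚ) 2) (hAa : (MA.baseChange ℚ).frobeniusTrace 2 = 0)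
    (hTam : ¬ 2 ∣ (MA.baseChange ℚ).tamagawaProduct) (hSha : ¬ 2 ∣ (MA.baseChange ℚ).shaOrder)
    (q r : ℚ[X])
    (hroot : ∀ ξ : AlgebraicClosure ℚ, Polynomial.aeval ξ (ME.baseChange ℚ).twoTorsionPolynomial.toPoly = 0 →
      Polynomial.aeval (Polynomial.aeval ξ q) (MA.baseChange ℚ).twoTorsionPolynomial.toPoly = 0)
    (hinv : ∀ ξ : AlgebraicClosure ℚ, Polynomial.aeval ξ (ME.baseChange ℚ).twoTorsionPolynomial.toPoly = 0 →
      Polynomial.aeval (Polynomial.aeval ξ q) r = ξ)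
    (hEC : ∀ (κ : ZpExtension ℚ 2) (γ : Field.absoluteGaloisGroup ℚ),
          κ.IsCyclotomic → κ.IsTopGenerator γ → Finite ((ME.baseChange ℚ).selmerGroupPInfty 2) →
          Finite (endInvariants (conjSignedSelmerInfty (ME.baseChange ℚ) κ 1 γ - 1)) ∧
            ∃ u : ℤ_[2]ˣ, (Nat.card (endInvariants (conjSignedSelmerInfty (ME.baseChange ℚ) κ 1 γ - 1)) : ℚ_[2]) =
              ((u : ℤ_[2]) : ℚ_[2]) * ((2 : ℕ) : ℚ_[2]) ^ (padicValNat 2 (ME.baseChange ℚ).tamagawaProduct) *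
                (Nat.card ((ME.baseChange ℚ).selmerGroupPInfty 2) : ℚ_[2]) *
                  (Nat.card (EndCoinvariants (conjSignedSelmerInfty (ME.baseChange ℚ) κ 1 γ - 1)) : ℚ_[2]))
    (hCK : ∀ (κ : ZpExtension ℚ 2) (γ : Field.absoluteGaloisGroup ℚ),
        κ.IsCyclotomic → κ.IsTopGenerator γ → IsCyclotomicVariable 2 γ →
        ∀ [NeZero ((ME.baseChange ℚ).conductorNorm ℤ)] (f : CuspForm (Gamma0 ((ME.baseChange ℚ).conductorNorm ℤ)) 2),
          IsNewformOf (ME.baseChange ℚ) f → ∀ (ϖ : ℚ), (ϖ : ℝ) * (ME.baseChange ℚ).realPeriodRat = plusPeriod f →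
        ∀ (Lplus Lminus : IwasawaAlgebra 2), IsPollackPair f 2 Lplus Lminus →
        ∀ (D : SignedSelmerDualData (ME.baseChange ℚ) κ γ 1) [ContinuousSMul ℤ_[2] ((ME.baseChange ℚ).tateModule 2)],
          ∃ (I : Kato2004.IwasawaH1Data (ME.baseChange ℚ) 2 κ γ) (Y : (ME.baseChange ℚ).FineSelmerDualData κ γ)
            (P : Submodule (IwasawaAlgebra 2) (IwasawaAlgebra 2))
            (loc : I.H →ₗ[IwasawaAlgebra 2] P) (toX : P →ₗ[IwasawaAlgebra 2] D.X)
            (δ : D.X →ₗ[IwasawaAlgebra 2] Y.X) (Z : Submodule (IwasawaAlgebra 2) I.H)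
            (G : IwasawaAlgebra 2),
            Function.Exact loc toX ∧ Function.Exact toX δ ∧
            G ∈ Submodule.map (P.subtype ∘ₗ loc) Z ∧
            iwasawaToPowerSeries 2 G =
              PowerSeries.C (ϖ : ℚ_[2]) * iwasawaToPowerSeries 2 (kobayashiL 1 Lplus Lminus) ∧
            (∀ 𝔭 : PrimeSpectrum (IwasawaAlgebra 2), 𝔭.asIdeal.height = 1 →
              PowerSeries.C (2 : ℤ_[2]) ∉ 𝔭.asIdeal →
              Literature.NumberTheory.EllipticCurves.Module.lengthAt (IwasawaAlgebra 2) Y.X 𝔭 ≤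
                Literature.NumberTheory.EllipticCurves.Module.lengthAt (IwasawaAlgebra 2) (I.H ⧸ Z) 𝔭))
    (hECA : ∀ (κ : ZpExtension ℚ 2) (γ : Field.absoluteGaloisGroup ℚ),
          κ.IsCyclotomic → κ.IsTopGenerator γ → Finite ((MA.baseChange ℚ).selmerGroupPInfty 2) →
          Finite (endInvariants (conjSignedSelmerInfty (MA.baseChange ℚ) κ 1 γ - 1)) ∧
            ∃ u : ℤ_[2]ˣ, (Nat.card (endInvariants (conjSignedSelmerInfty (MA.baseChange ℚ) κ 1 γ - 1)) : ℚ_[2]) =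
              ((u : ℤ_[2]) : ℚ_[2]) * ((2 : ℕ) : ℚ_[2]) ^ (padicValNat 2 (MA.baseChange ℚ).tamagawaProduct) *
                (Nat.card ((MA.baseChange ℚ).selmerGroupPInfty 2) : ℚ_[2]) *
                  (Nat.card (EndCoinvariants (conjSignedSelmerInfty (MA.baseChange ℚ) κ 1 γ - 1)) : ℚ_[2]))
    (hmuT : GoodSS (ME.baseChange ℚ) 2 → (ME.baseChange ℚ).frobeniusTrace 2 = 0 →
      GoodSS (MA.baseChange ℚ) 2 → (MA.baseChange ℚ).frobeniusTrace 2 = 0 →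
      (∃ e : WeierstrassCurve.geomTorsion (ME.baseChange ℚ) (2 : ℤ) ≃+ WeierstrassCurve.geomTorsion (MA.baseChange ℚ) (2 : ℤ),
        ∀ (σ : Field.absoluteGaloisGroup ℚ) (P : WeierstrassCurve.geomTorsion (ME.baseChange ℚ) (2 : ℤ)),
          e (σ • P) = σ • e P) →
      ∀ (κ : ZpExtension ℚ 2) (γ : Field.absoluteGaloisGroup ℚ), κ.IsCyclotomic → κ.IsTopGenerator γ →
      ∀ (D : SignedSelmerDualData (ME.baseChange ℚ) κ γ 1) (D' : SignedSelmerDualData (MA.baseChange ℚ) κ γ 1)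
        [Module.Finite (IwasawaAlgebra 2) D.X] [Module.Finite (IwasawaAlgebra 2) D'.X],
        Module.IsTorsion (IwasawaAlgebra 2) D.X → Module.IsTorsion (IwasawaAlgebra 2) D'.X →
        D'.mu = 0 → D.mu = 0)
    (ℓ : ℕ)
    (hlamT : GoodSS (ME.baseChange ℚ) 2 → (ME.baseChange ℚ).frobeniusTrace 2 = 0 →
      GoodSS (MA.baseChange ℚ) 2 → (MA.baseChange ℚ).frobeniusTrace 2 = 0 →
      (∃ e : WeierstrassCurve.geomTorsion (ME.baseChange ℚ) (2 : ℤ) ≃+ WeierstrassCurve.geomTorsion (MA.baseChange ℚ) (2 : ℤ),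
        ∀ (σ : Field.absoluteGaloisGroup ℚ) (P : WeierstrassCurve.geomTorsion (ME.baseChange ℚ) (2 : ℤ)),
          e (σ • P) = σ • e P) →
      ∀ (κ : ZpExtension ℚ 2) (γ : Field.absoluteGaloisGroup ℚ), κ.IsCyclotomic → κ.IsTopGenerator γ →
      ∀ (D : SignedSelmerDualData (ME.baseChange ℚ) κ γ 1) (D' : SignedSelmerDualData (MA.baseChange ℚ) κ γ 1)
        [Module.Finite (IwasawaAlgebra 2) D.X] [Module.Finite (IwasawaAlgebra 2) D'.X],
        Module.IsTorsion (IwasawaAlgebra 2) D.X → Module.IsTorsion (IwasawaAlgebra 2) D'.X →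
        D.mu = 0 → D'.mu = 0 → lambdaInvariant 2 D.X = lambdaInvariant 2 D'.X + ℓ)
    (hCert : ∀ (κ : ZpExtension ℚ 2) (γ : Field.absoluteGaloisGroup ℚ),
        κ.IsCyclotomic → κ.IsTopGenerator γ → IsCyclotomicVariable 2 γ →
        ∀ [NeZero ((ME.baseChange ℚ).conductorNorm ℤ)] (f : CuspForm (Gamma0 ((ME.baseChange ℚ).conductorNorm ℤ)) 2),
          IsNewformOf (ME.baseChange ℚ) f → ∀ (ϖ : ℚ), (ϖ : ℝ) * (ME.baseChange ℚ).realPeriodRat = plusPeriod f →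
        ∀ (Lplus Lminus : IwasawaAlgebra 2), IsPollackPair f 2 Lplus Lminus →
        ∀ (G : IwasawaAlgebra 2) (m : ℕ), iwasawaToPowerSeries 2 G =
            PowerSeries.C ((2 : ℚ_[2]) ^ m * (ϖ : ℚ_[2])) * iwasawaToPowerSeries 2 (kobayashiL 1 Lplus Lminus) →
          mu G = m ∧ lam G ≤ ℓ) :
    KobayashiMainConjecture (ME.baseChange ℚ) 2 1 := by
  obtain ⟨e, he⟩ := ThetaPartnerXRoute.exists_equivariant_addEquiv_geomTorsion_two_of_tschirnhaus (K := ℚ)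
    two_ne_zero (ME.baseChange ℚ) (MA.baseChange ℚ) q r hroot hinv
  exact kobayashiMainConjecture_two_of_unitAnchor (ME.baseChange ℚ) (MA.baseChange ℚ) hmod hGZK h124 hX0
    (analyticRank_eq_zero_of_entireLFunction_one_ne_zero _ hL) hss ha
    (analyticRank_eq_zero_of_entireLFunction_one_ne_zero _ hLA) hAss hAa hTam hSha e he hEC hCK hECA hmuT ℓ hlamT hCert


/-- **THE KIT DOOR, `Λ`-form: BSD₂ of `M_E ⊗ ℚ` WITHOUT a descent certificate.** The same binders ⟹ `BSDp (M_E ⊗ ℚ) 2`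
(Kim's control term at `E` from (2′), the tree's `a₂ = 0` door). [cite: Kobayashi2003, Thm. 1.2 and Conjecture (p. 2)]
[cite: BDKim2013, Cor. 3.15] [cite: BDKim2009, Cor. 2.13] [cite: Kato2004Asterisque, Thm. 12.5 (3)] [cite: Miller2011LMS, Def. 1.1] -/
theorem bsdp_two_baseChange_int_of_unitAnchor_of_reading
    (hmod : nonempty_modularParametrizationData) (hGZK : rank_eq_analyticRank_of_analyticRank_le_one)
    (h124 : Kato2004.thm12_4) (hX0 : Kato2004_fineSelmerDual_isTorsion)
    (hL : (ME.baseChange ℚ).entireLFunction 1 ≠ 0)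
    (hss : GoodSS (ME.baseChange ℚ) 2) (ha : (ME.baseChange ℚ).frobeniusTrace 2 = 0)
    (hLA : (MA.baseChange ℚ).entireLFunction 1 ≠ 0)
    (hAss : GoodSS (MA.baseChange ℚ) 2) (hAa : (MA.baseChange ℚ).frobeniusTrace 2 = 0)
    (hTam : ¬ 2 ∣ (MA.baseChange ℚ).tamagawaProduct) (hSha : ¬ 2 ∣ (MA.baseChange ℚ).shaOrder)
    (q r : ℚ[X])
    (hroot : ∀ ξ : AlgebraicClosure ℚ, Polynomial.aeval ξ (ME.baseChange ℚ).twoTorsionPolynomial.toPoly = 0 →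
      Polynomial.aeval (Polynomial.aeval ξ q) (MA.baseChange ℚ).twoTorsionPolynomial.toPoly = 0)
    (hinv : ∀ ξ : AlgebraicClosure ℚ, Polynomial.aeval ξ (ME.baseChange ℚ).twoTorsionPolynomial.toPoly = 0 →
      Polynomial.aeval (Polynomial.aeval ξ q) r = ξ)
    (hEC : ∀ (κ : ZpExtension ℚ 2) (γ : Field.absoluteGaloisGroup ℚ),
          κ.IsCyclotomic → κ.IsTopGenerator γ → Finite ((ME.baseChange ℚ).selmerGroupPInfty 2) →
          Finite (endInvariants (conjSignedSelmerInfty (ME.baseChange ℚ) κ 1 γ - 1)) ∧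
            ∃ u : ℤ_[2]ˣ, (Nat.card (endInvariants (conjSignedSelmerInfty (ME.baseChange ℚ) κ 1 γ - 1)) : ℚ_[2]) =
              ((u : ℤ_[2]) : ℚ_[2]) * ((2 : ℕ) : ℚ_[2]) ^ (padicValNat 2 (ME.baseChange ℚ).tamagawaProduct) *
                (Nat.card ((ME.baseChange ℚ).selmerGroupPInfty 2) : ℚ_[2]) *
                  (Nat.card (EndCoinvariants (conjSignedSelmerInfty (ME.baseChange ℚ) κ 1 γ - 1)) : ℚ_[2]))
    (hCK : ∀ (κ : ZpExtension ℚ 2) (γ : Field.absoluteGaloisGroup ℚ),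
        κ.IsCyclotomic → κ.IsTopGenerator γ → IsCyclotomicVariable 2 γ →
        ∀ [NeZero ((ME.baseChange ℚ).conductorNorm ℤ)] (f : CuspForm (Gamma0 ((ME.baseChange ℚ).conductorNorm ℤ)) 2),
          IsNewformOf (ME.baseChange ℚ) f → ∀ (ϖ : ℚ), (ϖ : ℝ) * (ME.baseChange ℚ).realPeriodRat = plusPeriod f →
        ∀ (Lplus Lminus : IwasawaAlgebra 2), IsPollackPair f 2 Lplus Lminus →
        ∀ (D : SignedSelmerDualData (ME.baseChange ℚ) κ γ 1) [ContinuousSMul ℤ_[2] ((ME.baseChange ℚ).tateModule 2)],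
          ∃ (I : Kato2004.IwasawaH1Data (ME.baseChange ℚ) 2 κ γ) (Y : (ME.baseChange ℚ).FineSelmerDualData κ γ)
            (P : Submodule (IwasawaAlgebra 2) (IwasawaAlgebra 2))
            (loc : I.H →ₗ[IwasawaAlgebra 2] P) (toX : P →ₗ[IwasawaAlgebra 2] D.X)
            (δ : D.X →ₗ[IwasawaAlgebra 2] Y.X) (Z : Submodule (IwasawaAlgebra 2) I.H)
            (G : IwasawaAlgebra 2),
            Function.Exact loc toX ∧ Function.Exact toX δ ∧
            G ∈ Submodule.map (P.subtype ∘ₗ loc) Z ∧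
            iwasawaToPowerSeries 2 G =
              PowerSeries.C (ϖ : ℚ_[2]) * iwasawaToPowerSeries 2 (kobayashiL 1 Lplus Lminus) ∧
            (∀ 𝔭 : PrimeSpectrum (IwasawaAlgebra 2), 𝔭.asIdeal.height = 1 →
              PowerSeries.C (2 : ℤ_[2]) ∉ 𝔭.asIdeal →
              Literature.NumberTheory.EllipticCurves.Module.lengthAt (IwasawaAlgebra 2) Y.X 𝔭 ≤
                Literature.NumberTheory.EllipticCurves.Module.lengthAt (IwasawaAlgebra 2) (I.H ⧸ Z) 𝔭))
    (hECA : ∀ (κ : ZpExtension ℚ 2) (γ : Field.absoluteGaloisGroup ℚ),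
          κ.IsCyclotomic → κ.IsTopGenerator γ → Finite ((MA.baseChange ℚ).selmerGroupPInfty 2) →
          Finite (endInvariants (conjSignedSelmerInfty (MA.baseChange ℚ) κ 1 γ - 1)) ∧
            ∃ u : ℤ_[2]ˣ, (Nat.card (endInvariants (conjSignedSelmerInfty (MA.baseChange ℚ) κ 1 γ - 1)) : ℚ_[2]) =
              ((u : ℤ_[2]) : ℚ_[2]) * ((2 : ℕ) : ℚ_[2]) ^ (padicValNat 2 (MA.baseChange ℚ).tamagawaProduct) *
                (Nat.card ((MA.baseChange ℚ).selmerGroupPInfty 2) : ℚ_[2]) *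
                  (Nat.card (EndCoinvariants (conjSignedSelmerInfty (MA.baseChange ℚ) κ 1 γ - 1)) : ℚ_[2]))
    (hmuT : GoodSS (ME.baseChange ℚ) 2 → (ME.baseChange ℚ).frobeniusTrace 2 = 0 →
      GoodSS (MA.baseChange ℚ) 2 → (MA.baseChange ℚ).frobeniusTrace 2 = 0 →
      (∃ e : WeierstrassCurve.geomTorsion (ME.baseChange ℚ) (2 : ℤ) ≃+ WeierstrassCurve.geomTorsion (MA.baseChange ℚ) (2 : ℤ),
        ∀ (σ : Field.absoluteGaloisGroup ℚ) (P : WeierstrassCurve.geomTorsion (ME.baseChange ℚ) (2 : ℤ)),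
          e (σ • P) = σ • e P) →
      ∀ (κ : ZpExtension ℚ 2) (γ : Field.absoluteGaloisGroup ℚ), κ.IsCyclotomic → κ.IsTopGenerator γ →
      ∀ (D : SignedSelmerDualData (ME.baseChange ℚ) κ γ 1) (D' : SignedSelmerDualData (MA.baseChange ℚ) κ γ 1)
        [Module.Finite (IwasawaAlgebra 2) D.X] [Module.Finite (IwasawaAlgebra 2) D'.X],
        Module.IsTorsion (IwasawaAlgebra 2) D.X → Module.IsTorsion (IwasawaAlgebra 2) D'.X →
        D'.mu = 0 → D.mu = 0)
    (ℓ : ℕ)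
    (hlamT : GoodSS (ME.baseChange ℚ) 2 → (ME.baseChange ℚ).frobeniusTrace 2 = 0 →
      GoodSS (MA.baseChange ℚ) 2 → (MA.baseChange ℚ).frobeniusTrace 2 = 0 →
      (∃ e : WeierstrassCurve.geomTorsion (ME.baseChange ℚ) (2 : ℤ) ≃+ WeierstrassCurve.geomTorsion (MA.baseChange ℚ) (2 : ℤ),
        ∀ (σ : Field.absoluteGaloisGroup ℚ) (P : WeierstrassCurve.geomTorsion (ME.baseChange ℚ) (2 : ℤ)),
          e (σ • P) = σ • e P) →
      ∀ (κ : ZpExtension ℚ 2) (γ : Field.absoluteGaloisGroup ℚ), κ.IsCyclotomic → κ.IsTopGenerator γ →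
      ∀ (D : SignedSelmerDualData (ME.baseChange ℚ) κ γ 1) (D' : SignedSelmerDualData (MA.baseChange ℚ) κ γ 1)
        [Module.Finite (IwasawaAlgebra 2) D.X] [Module.Finite (IwasawaAlgebra 2) D'.X],
        Module.IsTorsion (IwasawaAlgebra 2) D.X → Module.IsTorsion (IwasawaAlgebra 2) D'.X →
        D.mu = 0 → D'.mu = 0 → lambdaInvariant 2 D.X = lambdaInvariant 2 D'.X + ℓ)
    (hCert : ∀ (κ : ZpExtension ℚ 2) (γ : Field.absoluteGaloisGroup ℚ),
        κ.IsCyclotomic → κ.IsTopGenerator γ → IsCyclotomicVariable 2 γ →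
        ∀ [NeZero ((ME.baseChange ℚ).conductorNorm ℤ)] (f : CuspForm (Gamma0 ((ME.baseChange ℚ).conductorNorm ℤ)) 2),
          IsNewformOf (ME.baseChange ℚ) f → ∀ (ϖ : ℚ), (ϖ : ℝ) * (ME.baseChange ℚ).realPeriodRat = plusPeriod f →
        ∀ (Lplus Lminus : IwasawaAlgebra 2), IsPollackPair f 2 Lplus Lminus →
        ∀ (G : IwasawaAlgebra 2) (m : ℕ), iwasawaToPowerSeries 2 G =
            PowerSeries.C ((2 : ℚ_[2]) ^ m * (ϖ : ℚ_[2])) * iwasawaToPowerSeries 2 (kobayashiL 1 Lplus Lminus) →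
          mu G = m ∧ lam G ≤ ℓ) :
    BSDp (ME.baseChange ℚ) 2 := by
  obtain ⟨e, he⟩ := ThetaPartnerXRoute.exists_equivariant_addEquiv_geomTorsion_two_of_tschirnhaus (K := ℚ)
    two_ne_zero (ME.baseChange ℚ) (MA.baseChange ℚ) q r hroot hinv
  exact bsdp_two_of_unitAnchor_of_reading (ME.baseChange ℚ) (MA.baseChange ℚ) hmod hGZK h124 hX0
    (analyticRank_eq_zero_of_entireLFunction_one_ne_zero _ hL) hss ha
    (analyticRank_eq_zero_of_entireLFunction_one_ne_zero _ hLA) hAss hAa hTam hSha e he hEC hCK hECA hmuT ℓ hlamT hCert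


end Door

end SSUnitAnchor
end Summit.BirchSwinnertonDyer.BirchSwinnertonDyer.Theorems

end
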